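import Summits.RiemannHypothesis.RiemannHypothesis.Theorems.TiltedLandingLaw421R3Lens1MeridianOrd

/-!
# IMAGE «Lens1MeridianBase» v1 (lens-1 g12) — no pay point above a real zero or a repelling base critical point

For `f` entire and real on `ℝ` (`φ = phiAt f j`):
* (L7) `im_phi_neg_near_real_zero`: `Im φ < 0` just above a real zero of `f^{(j)}` of any order (`pole_expansion_ord` of «Lens1MeridianOrd» + reflection:
  `Ψ` is real on the axis, so `Im Ψ = O(y)` loses to the pole term `−m·y/|z − x₀|²`);
* (L6) `im_phi_neg_near_repelling_base_crit`: at a real `x₀` with `f^{(j)} x₀ ≠ 0 = f^{(j+1)} x₀` and `f^{(j)} f^{(j+2)} (x₀) < 0`, `Im φ < 0` just above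
  `x₀` (`dslope_expansion`: `φ z = (z − x₀)·χ z`, `χ x₀ = f^{(j+2)}/f^{(j)} (x₀) < 0`, `Im χ = O(y)` by reflection).
So a minimising sequence of the lift (G) of #172's (B1) meets the base only at `NLEventOf` points (the base-window exit).  (B1)/(B2), stub 1′ and
⟨27010⟩ stay OPEN; RH is not proved; nothing here asserts an open law.
-/

namespace RhW08.Lens1MeridianBase

open Complex Set Metric Literature.Analysis.Complex RhW08.Lens1ArcSign RhW08.Lens1MeridianOrd

/-- (L7) NO PAY POINT NEAR A REAL ZERO of `f^{(j)}` (`f` entire, real on `ℝ`, `f^{(j)} ≢ 0`): just above a real zero `x₀` of any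
order, `Im φ < 0` — the pole term `−m·y/|z − x₀|²` beats `Im Ψ = O(y)` (`Ψ` is real on the axis by reflection).  Disposes of the
«minimising sequence runs into a real zero of `f^{(j)}`» case of the lift (G). -/
theorem im_phi_neg_near_real_zero (f : ℂ → ℂ) (j : ℕ) (x₀ : ℝ) (hf : Differentiable ℂ f) (hreal : ∀ x : ℝ, (f x).im = 0)
    (hT : iteratedDeriv j f x₀ = 0) (hne : ∃ w, iteratedDeriv j f w ≠ 0) :
    ∃ r : ℝ, 0 < r ∧ ∀ z ∈ ball (x₀ : ℂ) r, 0 < z.im → (phiAt f j z).im < 0 := by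
  obtain ⟨m, hm1, r, M, hr, hM, Ψ, hΨc, hΨb, hΨL, hφ⟩ := pole_expansion_ord f j x₀ hf hT hne
  have hS := Literature.NumberTheory.LFunctions.iteratedDeriv_conj_of_conj (apply_conj_eq_conj hf hreal)
  have hGreal : ∀ (n : ℕ) (x : ℝ), (iteratedDeriv n f x).im = 0 := fun n x => by
    have := hS n x; rw [conj_ofReal] at this; exact conj_eq_iff_im.mp this.symm
  -- `φ` is real at real non-zeros, hence `Ψ` is real on the axis inside the ball (at `x₀` by continuity)
  have hφreal : ∀ x : ℝ, (phiAt f j x).im = 0 := fun x => by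
    unfold phiAt; rw [← iteratedDeriv_succ, Complex.div_im, hGreal, hGreal]; ring
  have hΨreal' : ∀ x : ℝ, (x : ℂ) ∈ ball (x₀ : ℂ) r → (x : ℂ) ≠ x₀ → (Ψ x).im = 0 := fun x hx hne' => by
    obtain ⟨-, hφx⟩ := hφ x hx hne'
    have : Ψ x = phiAt f j x - (m : ℂ) / (x - x₀) := by rw [hφx]; ring
    rw [this, Complex.sub_im, hφreal, ← Complex.ofReal_natCast, ← Complex.ofReal_sub, ← Complex.ofReal_div, Complex.ofReal_im]
    ring
  have hΨreal : ∀ x : ℝ, (x : ℂ) ∈ ball (x₀ : ℂ) r → (Ψ x).im = 0 := by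
    intro x hx
    by_cases hxx : (x : ℂ) = x₀
    · rw [hxx]
      by_contra hne0
      have hpos : 0 < |(Ψ x₀).im| := abs_pos.mpr hne0
      have hca : ContinuousAt Ψ (x₀ : ℂ) := hΨc.continuousAt (Metric.isOpen_ball.mem_nhds (Metric.mem_ball_self hr))
      obtain ⟨δ, hδ, hδε⟩ := Metric.continuousAt_iff.mp hca _ hpos
      set w : ℝ := x₀ + min δ r / 2 with hw
      have hwpos : 0 < min δ r / 2 := by have := lt_min hδ hr; positivity
      have hwdist : dist (w : ℂ) (x₀ : ℂ) = min δ r / 2 := by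
        rw [Complex.dist_of_im_eq (by simp), Complex.ofReal_re, Complex.ofReal_re, Real.dist_eq, hw, add_sub_cancel_left,
          abs_of_pos hwpos]
      have hwball : (w : ℂ) ∈ ball (x₀ : ℂ) r := by
        rw [Metric.mem_ball, hwdist]; linarith [min_le_right δ r]
      have hwne : (w : ℂ) ≠ x₀ := by
        intro h; have := congrArg Complex.re h; simp [hw] at this; linarith [lt_min hδ hr]
      have h0 := hΨreal' w hwball hwne
      have h1 := hδε (x := (w : ℂ)) (by rw [hwdist]; linarith [min_le_left δ r])
      have h2 : |(Ψ x₀).im| ≤ dist (Ψ w) (Ψ x₀) := by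
        rw [dist_eq_norm]
        calc |(Ψ ↑x₀).im| = |(Ψ ↑w - Ψ ↑x₀).im| := by rw [Complex.sub_im, h0, zero_sub, abs_neg]
          _ ≤ ‖Ψ ↑w - Ψ ↑x₀‖ := Complex.abs_im_le_norm _
      linarith
    · exact hΨreal' x hx hxx
  -- the radius
  set r₁ := min r (1 / (M + 1)) with hr₁def
  have hr₁ : 0 < r₁ := lt_min hr (by positivity)
  have hr₁r : r₁ ≤ r := min_le_left _ _
  have hr₁1 : r₁ ≤ 1 := (min_le_right _ _).trans (by rw [div_le_one (by positivity)]; linarith)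
  have hr₁M : r₁ * (M + 1) ≤ 1 := by
    calc r₁ * (M + 1) ≤ 1 / (M + 1) * (M + 1) := mul_le_mul_of_nonneg_right (min_le_right _ _) (by positivity)
      _ = 1 := by field_simp
  refine ⟨r₁, hr₁, fun z hz hy => ?_⟩
  have hzr : z ∈ ball (x₀ : ℂ) r := Metric.ball_subset_ball hr₁r hz
  have hzne : z ≠ x₀ := fun h => by rw [h, Complex.ofReal_im] at hy; exact lt_irrefl _ hy
  obtain ⟨-, hφz⟩ := hφ z hzr hzne
  -- the real projection of `z`
  have hxball : ((z.re : ℝ) : ℂ) ∈ ball (x₀ : ℂ) r := by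
    rw [Metric.mem_ball] at hzr ⊢
    refine lt_of_le_of_lt ?_ hzr
    rw [Complex.dist_of_im_eq (by simp), Complex.ofReal_re, Complex.ofReal_re, dist_eq_norm z]
    calc dist z.re x₀ = |(z - x₀).re| := by rw [Real.dist_eq, Complex.sub_re, Complex.ofReal_re]
      _ ≤ ‖z - ↑x₀‖ := Complex.abs_re_le_norm _
  have hΨim : (Ψ z).im ≤ M * z.im := by
    have hL := hΨL z hzr _ hxball
    have hnorm : ‖z - (z.re : ℂ)‖ = z.im := by
      have : z - (z.re : ℂ) = ((z.im : ℝ) : ℂ) * I := by apply Complex.ext <;> simp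
      rw [this, norm_mul, Complex.norm_real, Complex.norm_I, mul_one, Real.norm_eq_abs, abs_of_pos hy]
    rw [hnorm] at hL
    calc (Ψ z).im = (Ψ z - Ψ (z.re : ℂ)).im := by rw [Complex.sub_im, hΨreal z.re hxball, sub_zero]
      _ ≤ ‖Ψ z - Ψ (z.re : ℂ)‖ := (le_abs_self _).trans (Complex.abs_im_le_norm _)
      _ ≤ M * z.im := hL
  -- the pole term
  have hn : 0 < normSq (z - x₀) := Complex.normSq_pos.mpr (sub_ne_zero.mpr hzne)
  have hnsmall : normSq (z - x₀) < r₁ ^ 2 := by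
    rw [Complex.normSq_eq_norm_sq]; rw [Metric.mem_ball, dist_eq_norm] at hz
    exact pow_lt_pow_left₀ hz (norm_nonneg _) two_ne_zero
  have hpole : ((m : ℂ) / (z - x₀)).im = -(m * z.im) / normSq (z - x₀) := by
    rw [div_eq_mul_inv, Complex.mul_im, Complex.inv_re, Complex.inv_im, Complex.natCast_re, Complex.natCast_im, Complex.sub_im,
      Complex.ofReal_im, sub_zero]; ring
  rw [hφz, Complex.add_im, hpole]
  have hm1' : (1 : ℝ) ≤ m := by exact_mod_cast hm1
  have key : M * z.im * normSq (z - ↑x₀) < m * z.im := by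
    have h1 : normSq (z - ↑x₀) * (M + 1) < 1 := by
      calc normSq (z - ↑x₀) * (M + 1) < r₁ ^ 2 * (M + 1) := by
            exact mul_lt_mul_of_pos_right hnsmall (by positivity)
        _ ≤ r₁ * (M + 1) := by
            apply mul_le_mul_of_nonneg_right _ (by positivity); nlinarith
        _ ≤ 1 := hr₁M
    nlinarith [mul_pos hy hn]
  have h3 : (Ψ z).im < ↑m * z.im / normSq (z - ↑x₀) := lt_of_le_of_lt hΨim (by rw [lt_div_iff₀ hn]; exact key)
  rw [neg_div]; linarith

/-- first-order expansion `φ z = φ a + (z − a)·χ z` of an analytic `φ` at `a`, with `χ = dslope φ a` continuous and Lipschitz on a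
ball and `χ a = φ′ a`. -/
theorem dslope_expansion {φ : ℂ → ℂ} {a : ℂ} (ha : AnalyticAt ℂ φ a) :
    ∃ r L : ℝ, 0 < r ∧ 0 ≤ L ∧ ∃ χ : ℂ → ℂ, ContinuousOn χ (ball a r) ∧ χ a = deriv φ a ∧
      (∀ z₁ ∈ ball a r, ∀ z₂ ∈ ball a r, ‖χ z₁ - χ z₂‖ ≤ L * ‖z₁ - z₂‖) ∧ ∀ z ∈ ball a r, φ z = φ a + (z - a) * χ z := by
  obtain ⟨p, hp⟩ := ha
  have hχa : AnalyticAt ℂ (dslope φ a) a := ⟨_, hp.has_fpower_series_dslope_fslope⟩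
  obtain ⟨r₀, hr₀, hχ⟩ := hχa.exists_ball_analyticOnNhd
  have hcl : closedBall a (r₀ / 2) ⊆ ball a r₀ := Metric.closedBall_subset_ball (by linarith)
  obtain ⟨L, hL⟩ := (isCompact_closedBall a (r₀ / 2)).exists_bound_of_continuousOn (hχ.deriv.continuousOn.mono hcl)
  refine ⟨r₀ / 2, max L 0, by linarith, le_max_right _ _, dslope φ a,
    hχ.continuousOn.mono (Metric.ball_subset_closedBall.trans hcl), dslope_same φ a, ?_, ?_⟩
  · intro z₁ hz₁ z₂ hz₂
    exact Convex.norm_image_sub_le_of_norm_deriv_le (f := dslope φ a) (s := ball a (r₀ / 2))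
      (fun x hx => (hχ x (hcl (Metric.ball_subset_closedBall hx))).differentiableAt)
      (fun x hx => (hL x (Metric.ball_subset_closedBall hx)).trans (le_max_left _ _)) (convex_ball a (r₀ / 2)) hz₂ hz₁
  · intro z _
    have h := sub_smul_dslope φ a z
    rw [smul_eq_mul] at h
    linear_combination -h

/-- (L6) NO PAY POINT NEAR A REPELLING BASE CRITICAL POINT (`f` entire, real on `ℝ`): at a real `x₀` with `f^{(j)} x₀ ≠ 0`,
`f^{(j+1)} x₀ = 0` and `f^{(j)} f^{(j+2)} (x₀) < 0` one has `Im φ < 0` just above `x₀` — `φ z = (z − x₀) χ z` with `χ x₀ = f^{(j+2)}/f^{(j)} (x₀)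
< 0` and `Im χ = O(y)` by reflection.  Hence: if pay points accumulate at a base point `x₀` with `f^{(j)} x₀ ≠ 0`, then (continuity)
`f^{(j+1)} x₀ = 0` and (this lemma) `0 ≤ f^{(j)} f^{(j+2)} (x₀)`, i.e. `NLEventOf f j x₀` — the base-window exit of the lift (G). -/
theorem im_phi_neg_near_repelling_base_crit (f : ℂ → ℂ) (j : ℕ) (x₀ : ℝ) (hf : Differentiable ℂ f) (hreal : ∀ x : ℝ, (f x).im = 0)
    (hG : iteratedDeriv j f x₀ ≠ 0) (hG' : iteratedDeriv (j + 1) f x₀ = 0)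
    (hsign : (iteratedDeriv j f x₀).re * (iteratedDeriv (j + 2) f x₀).re < 0) :
    ∃ r : ℝ, 0 < r ∧ ∀ z ∈ ball (x₀ : ℂ) r, 0 < z.im → (phiAt f j z).im < 0 := by
  set G := iteratedDeriv j f with hGdef
  have hGd : Differentiable ℂ G := differentiable_iteratedDeriv_of_entire hf j
  have hG'd : Differentiable ℂ (deriv G) := by rw [hGdef, ← iteratedDeriv_succ]; exact differentiable_iteratedDeriv_of_entire hf _
  have hS := Literature.NumberTheory.LFunctions.iteratedDeriv_conj_of_conj (apply_conj_eq_conj hf hreal)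
  have hGreal : ∀ (n : ℕ) (x : ℝ), (iteratedDeriv n f x).im = 0 := fun n x => by
    have := hS n x; rw [conj_ofReal] at this; exact conj_eq_iff_im.mp this.symm
  have hφreal : ∀ x : ℝ, (phiAt f j x).im = 0 := fun x => by
    unfold phiAt; rw [← iteratedDeriv_succ, Complex.div_im, hGreal, hGreal]; ring
  have hφeq : phiAt f j = deriv G / G := by funext z; rfl
  have hφa : AnalyticAt ℂ (phiAt f j) (x₀ : ℂ) := by
    rw [hφeq]; exact (hGd.analyticAt _).deriv.div (hGd.analyticAt _) hG
  have hφ0 : phiAt f j (x₀ : ℂ) = 0 := by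
    show deriv G x₀ / G x₀ = 0
    rw [hGdef, ← iteratedDeriv_succ, hG', zero_div]
  -- the derivative `φ′(x₀) = f^{(j+2)}/f^{(j)} (x₀)` is real and negative
  set c : ℝ := (iteratedDeriv (j + 2) f x₀).re / (iteratedDeriv j f x₀).re with hcdef
  have hGre : (iteratedDeriv j f x₀).re ≠ 0 := fun h => hG (Complex.ext h (hGreal j x₀))
  have hc : c < 0 := by
    rcases mul_neg_iff.mp hsign with ⟨h1, h2⟩ | ⟨h1, h2⟩
    · exact div_neg_of_neg_of_pos h2 h1
    · exact div_neg_of_pos_of_neg h2 h1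
  have hderiv : deriv (phiAt f j) (x₀ : ℂ) = (c : ℂ) := by
    rw [hφeq, deriv_div (hG'd _) (hGd _) hG]
    have e1 : deriv G (x₀ : ℂ) = 0 := by rw [hGdef, ← iteratedDeriv_succ, hG']
    have e2 : deriv (deriv G) (x₀ : ℂ) = iteratedDeriv (j + 2) f x₀ := by rw [hGdef, ← iteratedDeriv_succ, ← iteratedDeriv_succ]
    have eG : G (x₀ : ℂ) = ((iteratedDeriv j f x₀).re : ℂ) := (Complex.ext rfl (by simpa using hGreal j x₀))
    have eG2 : iteratedDeriv (j + 2) f x₀ = ((iteratedDeriv (j + 2) f x₀).re : ℂ) :=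
      (Complex.ext rfl (by simpa using hGreal (j + 2) x₀))
    rw [e1, e2, zero_mul, sub_zero, eG2, eG, hcdef, Complex.ofReal_div]
    have hne : (((iteratedDeriv j f ↑x₀).re : ℝ) : ℂ) ≠ 0 := by exact_mod_cast hGre
    field_simp
  -- first-order expansion
  obtain ⟨r, L, hr, hL, χ, hχc, hχ0, hχL, hexp⟩ := dslope_expansion hφa
  rw [hderiv] at hχ0
  have hχreal : ∀ x : ℝ, (x : ℂ) ∈ ball (x₀ : ℂ) r → (χ x).im = 0 := by
    intro x hx
    by_cases hxx : (x : ℂ) = x₀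
    · rw [hxx, hχ0, Complex.ofReal_im]
    · have h := hexp x hx
      rw [hφ0, zero_add] at h
      have hne : (x : ℂ) - x₀ ≠ 0 := sub_ne_zero.mpr hxx
      have : χ x = phiAt f j x / ((x : ℂ) - x₀) := by rw [h]; field_simp
      rw [this, ← Complex.ofReal_sub, Complex.div_ofReal_im, hφreal, zero_div]
  -- continuity of `χ` at `x₀`: `Re χ ≤ c/2` nearby
  have hca : ContinuousAt χ (x₀ : ℂ) := hχc.continuousAt (Metric.isOpen_ball.mem_nhds (Metric.mem_ball_self hr))
  obtain ⟨δ, hδ, hδε⟩ := Metric.continuousAt_iff.mp hca (-c / 2) (by linarith)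
  -- the radius
  set r₁ := min (min r δ) (-c / (4 * (L + 1))) with hr₁def
  have hr₁ : 0 < r₁ := lt_min (lt_min hr hδ) (div_pos (by linarith) (by positivity))
  refine ⟨r₁, hr₁, fun z hz hy => ?_⟩
  have hzr : z ∈ ball (x₀ : ℂ) r := Metric.ball_subset_ball ((min_le_left _ _).trans (min_le_left _ _)) hz
  have hzδ : dist z (x₀ : ℂ) < δ := Metric.ball_subset_ball ((min_le_left _ _).trans (min_le_right _ _)) hz
  have hzc : ‖z - x₀‖ < -c / (4 * (L + 1)) := by
    rw [← dist_eq_norm]; exact Metric.ball_subset_ball (min_le_right _ _) hz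
  -- real projection in the ball, `Im χ z ≤ L·y`-type bound
  have hxball : ((z.re : ℝ) : ℂ) ∈ ball (x₀ : ℂ) r := by
    rw [Metric.mem_ball] at hzr ⊢
    refine lt_of_le_of_lt ?_ hzr
    rw [Complex.dist_of_im_eq (by simp), Complex.ofReal_re, Complex.ofReal_re, dist_eq_norm z]
    calc dist z.re x₀ = |(z - x₀).re| := by rw [Real.dist_eq, Complex.sub_re, Complex.ofReal_re]
      _ ≤ ‖z - ↑x₀‖ := Complex.abs_re_le_norm _
  have hnorm : ‖z - (z.re : ℂ)‖ = z.im := by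
    have : z - (z.re : ℂ) = ((z.im : ℝ) : ℂ) * I := by apply Complex.ext <;> simp
    rw [this, norm_mul, Complex.norm_real, Complex.norm_I, mul_one, Real.norm_eq_abs, abs_of_pos hy]
  have hχim : |(χ z).im| ≤ L * z.im := by
    have hLz := hχL z hzr _ hxball
    rw [hnorm] at hLz
    calc |(χ z).im| = |(χ z - χ (z.re : ℂ)).im| := by rw [Complex.sub_im, hχreal z.re hxball, sub_zero]
      _ ≤ ‖χ z - χ (z.re : ℂ)‖ := Complex.abs_im_le_norm _
      _ ≤ L * z.im := hLz
  have hχre : (χ z).re ≤ c / 2 := by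
    have h1 := hδε hzδ
    rw [hχ0, dist_eq_norm] at h1
    have h2 : |(χ z).re - c| ≤ ‖χ z - (c : ℂ)‖ := by
      rw [← Complex.ofReal_re c, ← Complex.sub_re]; exact Complex.abs_re_le_norm _
    linarith [(abs_le.mp (h2.trans h1.le)).2]
  -- conclusion
  have hφz := hexp z hzr
  rw [hφ0, zero_add] at hφz
  rw [hφz, Complex.mul_im, Complex.sub_re, Complex.sub_im, Complex.ofReal_re, Complex.ofReal_im, sub_zero]
  have hxabs : |z.re - x₀| ≤ ‖z - ↑x₀‖ := by
    rw [← Complex.ofReal_re x₀, ← Complex.sub_re]; exact Complex.abs_re_le_norm _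
  have h1 : (z.re - x₀) * (χ z).im ≤ ‖z - ↑x₀‖ * (L * z.im) := by
    calc (z.re - x₀) * (χ z).im ≤ |(z.re - x₀) * (χ z).im| := le_abs_self _
      _ = |z.re - x₀| * |(χ z).im| := abs_mul _ _
      _ ≤ ‖z - ↑x₀‖ * (L * z.im) := mul_le_mul hxabs hχim (abs_nonneg _) (norm_nonneg _)
  have h2 : ‖z - ↑x₀‖ * (L * z.im) ≤ -c / (4 * (L + 1)) * ((L + 1) * z.im) :=
    mul_le_mul hzc.le (by nlinarith) (by positivity) (div_nonneg (by linarith) (by positivity))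
  have h3 : -c / (4 * (L + 1)) * ((L + 1) * z.im) = -c / 4 * z.im := by field_simp
  have h4 : z.im * (χ z).re ≤ z.im * (c / 2) := mul_le_mul_of_nonneg_left hχre hy.le
  nlinarith

end RhW08.Lens1MeridianBase
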